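import Literature.NumberTheory.GaloisRepresentations.LubinTateColemanRelativeGaloisActionTwo
import HarnessLib

/-!
# Laws of the Galois action on the relative norm-coherent units: `σ̃ · β` depends only on `σ̃|_E` and `χ_π(σ̃)`,
# composes, and is trivial when `σ̃` fixes `E` with `χ_π(σ̃) = 1` — de Shalit I.1.8 / I.2.3 (iv): `Gal(k_ξ/k') ≅ 𝒪ˣ` acts on `𝒰`

De Shalit, *Iwasawa theory of elliptic curves with complex multiplication* (1987), Ch. I §1.8, §2.3 (iv), §3.4 Lemma (ii):
the group `G = Gal(k_ξ/k')` acts on the norm-coherent units `𝒰` of the relative tower, and `G ≅ 𝒪ˣ` through `κ`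
(`u ↦ σ_u`, `σ_u(ω) = [u⁻¹]_f(ω)`).  In the tree's currency (`RelNormCoherentUnits hπ E` along `E·K_π^{m+1}`,
`E` finite normal over `F`; the action `RelNormCoherentUnits.galAct σ̃` of `σ̃ ∈ Γ_F` through the restrictions
`relRestrict hπ E m σ̃`, file `LubinTateColemanRelativeGaloisActionTwo`) THIS file proves the laws that make
`σ̃ ↦ galAct σ̃` an action of the CHARACTER: for `σ̃, τ̃` fixing `E` pointwise,

* `relRestrict_congr` — `χ_π(σ̃) = χ_π(τ̃) ⟹ σ̃|_{E·K_π^{m+1}} = τ̃|_{E·K_π^{m+1}}` (an automorphism fixing `E` is determined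
  by its value `[χ_π]λ'` on the base point: `algEquiv_eq_of_forall_apply_inclusion_eq`, `mapPt_relRestrict_relAct`);
* ★ `galAct_congr` — **`χ_π(σ̃) = χ_π(τ̃) ⟹ σ̃·β = τ̃·β`** (so `u ↦ σ_u·β` is well defined on `𝒪ˣ`);
* `relRestrict_eq_one_of_lubinTateChar_eq_one`, ★ `galAct_eq_self` — `χ_π(σ̃) = 1 ⟹ σ̃·β = β`;
* `galAct_one` (`1·β = β`), ★ `galAct_mul_left` — **`σ̃·(τ̃·β) = (σ̃τ̃)·β`** (`relRestrict_mul`), `galAct_one_right'`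
  (`σ̃·1 = 1`).

With these, any homomorphism `φ : G →* 𝒪_Fˣ` and any choice of lifts `σ̃_a ∈ Γ_F` (fixing `E`, `χ_π(σ̃_a) = a`) define a
`MulDistribMulAction` of `G` on `RelNormCoherentUnits hπ E` — the semi-local Galois module of de Shalit II.4.5 at one
prime (`PAdicOneVariableRelNormCoherentUnitsRayAction.lean`).  0 sorry, no named facts, no definitions, no instances.

## References

* E. de Shalit, *Iwasawa theory of elliptic curves with complex multiplication* (1987), Ch. I §1.8 Prop., §2.3 (iv),
  §3.4 Lemma (ii). [deShalit1987]
* J.-P. Serre, *Local class field theory*, Ch. VI of Cassels–Fröhlich (1967), §3.6 Prop. 6 (b). [CasselsFrohlichANT1967]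
-/

noncomputable section

open Filter Topology
open scoped PowerSeries.WithPiTopology

namespace Literature.NumberTheory.GaloisRepresentations

section RelativeGaloisActionLaws

open GaloisRepresentations.IsNonarchimedeanLocalField LubinTate ValuativeRel Field

variable {F : Type} [Field F] [ValuativeRel F] [TopologicalSpace F] [IsNonarchimedeanLocalField F]

attribute [local instance] ltNormUniformSpace ltNormIsUniformAddGroup rk1 nF nE fintypeResidueField

variable {π : 𝒪[F]} (hπ : (valuation F).IsUniformizer (π : F))
variable (E : IntermediateField F (AlgebraicClosure F)) [FiniteDimensional F E] [Normal F E] (m : ℕ)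

/-! ### The restriction `σ̃|_{E·K_π^{m+1}}` depends only on `σ̃|_E` and `χ_π(σ̃)` -/

/-- **`χ_π(σ̃) = χ_π(τ̃)` and both fix `E` ⟹ `σ̃|_{E·K_π^{m+1}} = τ̃|_{E·K_π^{m+1}}`.** [cite: deShalit1987, Ch. I §1.8]
[cite: CasselsFrohlichANT1967, Ch. VI §3.6 Prop. 6 (b)] -/
theorem relRestrict_congr {σ τ : absoluteGaloisGroup F} (hσ : ∀ x : E, σ • (x : AlgebraicClosure F) = x)
    (hτ : ∀ x : E, τ • (x : AlgebraicClosure F) = x) (h : lubinTateChar hπ σ = lubinTateChar hπ τ) :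
    relRestrict hπ E m σ = relRestrict hπ E m τ := by
  refine algEquiv_eq_of_forall_apply_inclusion_eq hπ E m (relRestrict_apply_inclusion hπ E m hσ)
    (relRestrict_apply_inclusion hπ E m hτ) ?_
  have e1 := mapPt_relRestrict_relAct hπ E m σ 1
  have e2 := mapPt_relRestrict_relAct hπ E m τ 1
  rw [relAct_one] at e1 e2
  rw [e1, e2, h]

/-- **`χ_π(σ̃) = 1` and `σ̃` fixes `E` ⟹ `σ̃|_{E·K_π^{m+1}} = 1`.** [cite: deShalit1987, Ch. I §1.8] -/
theorem relRestrict_eq_one_of_lubinTateChar_eq_one {σ : absoluteGaloisGroup F}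
    (hσ : ∀ x : E, σ • (x : AlgebraicClosure F) = x) (h : lubinTateChar hπ σ = 1) :
    relRestrict hπ E m σ = 1 := by
  rw [← map_one (lubinTateCharHom hπ), lubinTateCharHom_apply] at h
  rw [relRestrict_congr hπ E m hσ (fun x ↦ by rw [one_smul]) h, relRestrict, map_one, map_one]

namespace RelNormCoherentUnits

variable {hπ E}

/-- ★ **`χ_π(σ̃) = χ_π(τ̃)` (both fixing `E`) ⟹ `σ̃·β = τ̃·β`**: the action of `Γ_F`'s `E`-fixing part on the relative
norm-coherent units factors through the Lubin–Tate character — de Shalit's `Gal(k_ξ/k') ≅ 𝒪ˣ` acting on `𝒰`.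
[cite: deShalit1987, Ch. I §1.8, §2.3 (iv)] -/
theorem galAct_congr (β : RelNormCoherentUnits hπ E) {σ τ : absoluteGaloisGroup F}
    (hσ : ∀ x : E, σ • (x : AlgebraicClosure F) = x) (hτ : ∀ x : E, τ • (x : AlgebraicClosure F) = x)
    (h : lubinTateChar hπ σ = lubinTateChar hπ τ) : β.galAct σ = β.galAct τ := by
  refine RelNormCoherentUnits.ext fun m => ?_
  change toUnitBallHom (relRestrict hπ E m σ) (β.val m) = toUnitBallHom (relRestrict hπ E m τ) (β.val m)
  rw [relRestrict_congr hπ E m hσ hτ h]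

/-- ★ **`χ_π(σ̃) = 1` (σ̃ fixing `E`) ⟹ `σ̃·β = β`.** [cite: deShalit1987, Ch. I §1.8, §2.3 (iv)] -/
theorem galAct_eq_self (β : RelNormCoherentUnits hπ E) {σ : absoluteGaloisGroup F}
    (hσ : ∀ x : E, σ • (x : AlgebraicClosure F) = x) (h : lubinTateChar hπ σ = 1) : β.galAct σ = β := by
  refine RelNormCoherentUnits.ext fun m => ?_
  change toUnitBallHom (relRestrict hπ E m σ) (β.val m) = β.val m
  rw [relRestrict_eq_one_of_lubinTateChar_eq_one hπ E m hσ h]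
  exact Subtype.ext rfl

/-- `1·β = β` (the identity of `Γ_F`). [cite: deShalit1987, Ch. I §2.3 (iv)] -/
theorem galAct_one (β : RelNormCoherentUnits hπ E) : β.galAct 1 = β := by
  refine RelNormCoherentUnits.ext fun m => ?_
  change toUnitBallHom (relRestrict hπ E m 1) (β.val m) = β.val m
  rw [relRestrict, map_one, map_one]
  exact Subtype.ext rfl

/-- ★ **`σ̃·(τ̃·β) = (σ̃τ̃)·β`** (the restrictions are multiplicative). [cite: deShalit1987, Ch. I §2.3 (iv)] -/
theorem galAct_mul_left (β : RelNormCoherentUnits hπ E) (σ τ : absoluteGaloisGroup F) :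
    (β.galAct τ).galAct σ = β.galAct (σ * τ) := by
  refine RelNormCoherentUnits.ext fun m => ?_
  change toUnitBallHom (relRestrict hπ E m σ) (toUnitBallHom (relRestrict hπ E m τ) (β.val m)) =
    toUnitBallHom (relRestrict hπ E m (σ * τ)) (β.val m)
  rw [relRestrict_mul]
  exact Subtype.ext rfl

/-- `σ̃·1 = 1`. [cite: deShalit1987, Ch. I §2.3 (iv)] -/
theorem galAct_one_right' (σ : absoluteGaloisGroup F) :
    (RelNormCoherentUnits.one : RelNormCoherentUnits hπ E).galAct σ = RelNormCoherentUnits.one := by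
  refine RelNormCoherentUnits.ext fun m => ?_
  change toUnitBallHom (relRestrict hπ E m σ) 1 = 1
  exact map_one _

end RelNormCoherentUnits

end RelativeGaloisActionLaws

end Literature.NumberTheory.GaloisRepresentations

end
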